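import Mathlib
import Summits.HodgeConjecture.HodgeConjecture.Theorems.HodgeLocusCensusGKStencilClosedForms

-- `Summit.HodgeConjecture.HodgeConjecture.…` (summit = sub-problem for this single-conjunct summit) trips `linter.dupNamespace`
-- on every declaration; the duplication is the tree's naming convention (D-0017), as in anchor 100 and the sibling census sheets.
set_option linter.dupNamespace false

/-!
# Hodge-locus census — the dyadic dictionary, II: ENGINE B's exact-level Gross–Keating weights at ℓ = 2 are the odd-p stencil at p = 2
# (ENGINE B, abs-2, gen 63; programme P-DY-B, ruling R-L370 of LEAD gen 46; record `DERIVATIONS_engineB.md` §69.40)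

certified instances and evidence bearing on the general Hodge conjecture; no claim.

Def-free; imports Mathlib and the cell's anchor 100 (`HodgeLocusCensusGKStencilClosedForms`, B g59) only; sorry-free; no `decide` /
`native_decide`; standard axioms.  Every identity holds for ALL integer parameters `t, δ₀` and all levels in the stated ranges.
TWO FILES (gate lint: Theorems files ≤ 400 lines): I = `HodgeLocusCensusGKDyadicDictionary` (imports Mathlib only: Layer A — the
printed `p = 2` typing rules give (DY) case by case; Layer C — the `δ₀` vector algebra) and II = `HodgeLocusCensusGKStencilDyadic`
(imports Mathlib + anchor 100: Layers B/B′ — the weights).  The two files are logically independent (II takes (DY) and `2δ₀ = t−1`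
as hypotheses `hF`, `hδ`; I shows where they come from); same programme, same record §69.40, same labels.

LABEL CEILING (R-L370 (c), the LEAD's text of record; this file claims nothing above it): 'kernel-checked algebra: (i) GIVEN the printed
p = 2 typing rules [KRY06 §3.6 (A)/(B) = Yang04 Prop B.4/B.5] as hypotheses and GIVEN the 2-adic Jordan type of each case, the Gross–Keating
data of the census's diag(1, T(x₁,x₂)) have the dictionary form (DY) = anchor 100's stencil data at p = 2 under E ↦ R, O ↦ U, t ↦ t′;
(ii) with [KRY06 Thm 3.6.3]'s ν₂ the exact-level weights then equal the UL/LL per-pair constants of record (m = 2^{L−1}(2+t),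
2^{L−1}(3t−1)/4, ω·2^{L_low}) for all levels and all t, and at the O–O level-(1,1) corner under δ₀ = (t−1)/2, reduced to a proved vector
identity plus Gross's QUOTED definition [KRY06 (3.6.11)].  (DY) as a statement about every pair = DERIVED FROM PRINT by one seat's written
case analysis (DERIVATION-DY.md §69.40), LEAD-read, CHECKED against g62's three printed typings on 533 168 cells and by the LEAD's own driver on
an independent box; the per-pair Jordan typing, the realisability of t and Theorem G's modelling of v₂(Res) are NOT in the kernel'.
Theorem G (ENGINE B g60, `DERIVATION-GKD.md` 4192ab00d1b2: 'derived from print, pending third reading') is NEITHER kernel-checked here NOR a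
cited fact anywhere (ABSOLUTE RULE); nothing in this file is a statement about the Hodge conjecture.

OBJECTS (cell conventions of ENGINE B g58–g62; `g62/e3/e3tie.py` 56edff00f7ff, `READING-E3-B.md`).  ℓ = 2, one supersingular point,
`O_D ∩ B` = the Hurwitz order, `u = 24`.  A census discriminant is `d = 4^L d₀` with 2-LEVEL `L` and 2-ROOT `d₀` (conductor odd at 2); its
KIND is E (`K = ℚ(√d₀)` ramified at 2: `d₀ = −4c`, `c ≡ 1, 2 (mod 4)`) or O (`K` inert at 2: `d₀ = −c`, `c ≡ 3 (mod 8)`).  Optimal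
embeddings of the root order ↔ primitive `u ∈ ℤ³` with `|u|² = c` (trace-zero Hurwitz coordinates); the trace-zero generator of the
level-`S` order is `x = 2^S u` (kind E, `S ≥ 0`) and `x = 2^{S−1} u` (kind O, `S ≥ 1`; at `S = 0` the inert maximal order has no trace-zero
generator — the canonical-lift corner, clause (E3) of Theorem G).  For a pair put `cᵢ = |uᵢ|²`, `z = u₁·u₂`, `t = v₂(c₁c₂ − z²)`,
`T(x₁,x₂) = [[x₁·x₁, x₁·x₂],[x₁·x₂, x₂·x₂]]`, and let `(0, a₂, a₃)` be the Gross–Keating invariants of `T̃ = diag(1, T(x₁,x₂))` over `ℤ₂`.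
THE DICTIONARY (DY) (§69.40): with `ε_E = 1`, `ε_O = 0`,
    `a₂ = min(2S₁+ε₁, 2S₂+ε₂)`,   `a₂ + a₃ = 2S₁ + 2S₂ + t + 2(ε₁+ε₂−1)`,
i.e. EXACTLY anchor 100's stencil data `a₁ = min(2S₁+e₁, 2S₂+e₂)`, `s = 2S₁+2S₂+t′` at `p = 2` with `e = ε` (E ↦ R, O ↦ U) and
`t′ = t+2` (E,E), `t′ = t` (E,O), `t′ = t−2` (O,O).  [KRY06 Thm 3.6.3, p0062] (S. Kudla, M. Rapoport, T. Yang, *Modular forms and special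
cycles on Shimura curves*, Ann. of Math. Stud. 161 (2006); valid for `p = 2`): `ν₂(T̃) = Σ_{j ≤ (a₂−1)/2} (a₂+a₃−4j) 2^j` (`a₂` odd),
`= Σ_{j < a₂/2} (a₂+a₃−4j) 2^j + ½(a₃−a₂+1) 2^{a₂/2}` (`a₂` even) — as a function of `(a₂, s = a₂+a₃)` these are anchor 100's doubled clauses
`hodd`/`heven` at `p = 2` VERBATIM (`Φ = 2ν₂`; `a₃ − a₂ = s − 4m` at `a₂ = 2m`), so `Φ : ℕ → ℤ → ℤ` below is ANY function satisfying them and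
`F : ℕ → ℕ → ℤ` is ANY function with `hF : F S₁ S₂ = Φ (dictionary data)` on the route region (= `2·G(S₁,S₂)` of Theorem G (E2)); the
exact-level weight at levels `Lᵢ = Mᵢ+1` is `w = Δ₁Δ₂G`, every Layer-B conclusion is `2w = F(L₁,L₂) − F(L₁−1,L₂) − F(L₁,L₂−1) + F(L₁−1,L₂−1)`
in closed form, and the census's per-pair multiplicity is `m = w/2` (`24·v₂ = Σ_pairs m`, Theorem G (C3)).  DEGREES `e_L(E) = 2^{L+1}`,
`e_L(O) = 3·2^{L−1}` (`L ≥ 1`), `e_0(O) = 1` ([KRY06 (3.6.12), p0063] at `p = 2`).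

CONTENT, with the per-clause status labels of §69.34/§69.36 (DERIVED = proved here in the kernel from the stated hypotheses; QUOTED = a
printed statement entering as a hypothesis, locator given; CHECKED = finite machine comparison, two implementations, not kernel):
* LAYER B (DERIVED; anchor 100 APPLIED at `p = 2` with `t′` substituted, its hypotheses unaltered): E-tie `2w = (t+2)·2^{L+1}` (`ee_tie` ←
  `stencil_tie_R`), i.e. `m = 2^{L−1}(2+t)` = UL-E of record; O-tie `2w = 2^{L−1}(3t−1)`, `L ≥ 2` (`oo_tie` ← `stencil_tie_U`), i.e.
  `m = 2^{L−1}(3t−1)/4` = UL-O of record; off-tie `2w = 2·min(e_{L₁}(k₁), e_{L₂}(k₂))` on every level configuration of the route region: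
  `ee_sep` (← `stencil_sep_R`), `eo_sep_E` (← `stencil_sep_R`, `e₂ = 0`), `eo_adj_E`/`_one` (← `stencil_adj_RU`; general `t`: `(t+3)2^L`),
  `eo_sep_O` (← `stencil_sep_U'`), `oo_sep` (← `stencil_sep_U`), and the equal-level mixed pair `eo_eq_O`/`_one` (`2w = 2·3·2^{L−1} + (t−1)2^L`;
  this E-first mirror of `stencil_adj_UR` is not among anchor 100's theorems and is proved here by anchor 100's two ingredients `sum_affine` +
  `Finset.sum_range_succ`, same `hodd`/`heven`) — i.e. `m = ω·2^{L_low}`, `ω = 1` (E low) / `3/4` (O low) = LL of record, given (R1).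
* LAYER B′ (DERIVED given QUOTED (E3)): the corners with a kind-O side at level 0, where Theorem G's clause (E3) supplies `G(S,0) = S+1`
  against kind E and `G(0,S) = δ₀ + S` (`S ≥ 1`), `G(0,0) = δ₀` against kind O — entering ONLY as hypotheses `hE3…` [(E3) first clause =
  (E1) of Theorem G, DERIVED in `DERIVATION-GKD.md` §3; second clause = Gross's `δ₀ = 1 + max{m : ψ′(O_{k′}) ⊂ ψ(O_k) + 2^m O_D}`, QUOTED
  from [KRY06 (3.6.11)–(3.6.12) at r = 0, p0063], resting on their ref. [15]]: `eo_O1`, `oo_1L` (`2w = 6 = 2e_1(O)`), `eo_11` (`4+2t`; `= 6` at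
  `t = 1`), `eo_01` (`2t+2`; `= 4 = 2e_0(E)` at `t = 1`), `oo_11` (`2w = 4t − 2 − 2δ₀`) and `oo_11_dict` (`2w = 3t − 1` under `2δ₀ = t − 1`,
  i.e. `m = (3t−1)/4` = UL-O1 of record); and the kind-E level-0 boundary `ee_0L`, `eo_0L` (`2w = 4 = 2e_0(E)`: E′/LL with `L_low = 0`), `ee_00`.
(Layers A and C — where the hypotheses `hF` (the dictionary (DY)) and `hδ : 2δ₀ = t − 1` come from — are file I,
`HodgeLocusCensusGKDyadicDictionary`; REALISABILITY (R1) kinds differ ⇒ `t = 1` is §69.40 (R), a parity count, NOT kernel; (R2) O–O ⇒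
`t = 2μ+1` is file I's `delta0_dictionary`; the `_one` / `_dict` corollaries below are the realisable specialisations.)

WHAT THIS SUPERSEDES, AND WHAT NOT.  §69.32a's wording 'coincide on the enumerated range (88 + 340 cell types, c ≤ 35, levels ≤ 4); no
symbolic proof for all (c, L, t) is filed' is superseded FOR THE PER-PAIR WEIGHTS ONLY: given (DY) per pair, `w_GK = 2·m_UL` is an identity
in `(L, t)` for all levels and all `t` (Layers B/B′).  NOT superseded / not touched: TL's κ-table; every census number, verdict and count
(nothing changes); the labels of Theorem G and of (E3); [KRY06]'s `p = 2` tables themselves (QUOTED, typed three ways by g62, never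
re-derived).  LIMITS: the kernel sees polynomial identities in `(t, δ₀, 2^M)` under hypotheses; it does not see quaternion orders,
embeddings, resultants, or which Jordan case a pair is in.  Other implementations (cell rule): §69.40 hand derivation; `dy/check_w.py`
(Layer B/B′/C closed forms v. g62's `w_value`/`delta0_closed` pair by pair); g62's registered P-E3-B (4 850/4 850 rows v. exact resultants,
R-L366) is the evidence of record that the machine these identities describe matches the truth.
-/

namespace Summit.HodgeConjecture.HodgeConjecture.HodgeLocus.Census.GKStencilDyadic

open Finset
open Summit.HodgeConjecture.HodgeConjecture.HodgeLocus.Census.GKStencilClosedForms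

/-! ## Layer B — the stencil at `p = 2` (both sides on the Gross–Keating route at all four corners) -/

/-- E-tie `(E,L)|(E,L)`, `L = M+1 ≥ 1`: `2w = 4·(t+2)·2^{L-1}`, i.e. the UL weight `m = w/2 = 2^{L−1}(2+t)`.
Dictionary: `a₂ = min(2S₁+1, 2S₂+1)`, `s = 2S₁+2S₂+(t+2)`; this is `stencil_tie_R` at `p = 2` with `t ↦ t+2`. -/
theorem ee_tie (t : ℤ) (Φ : ℕ → ℤ → ℤ) (F : ℕ → ℕ → ℤ)
    (hodd : ∀ (m : ℕ) (s : ℤ), Φ (2 * m + 1) s = 2 * ∑ j ∈ range (m + 1), (s - 4 * (j : ℤ)) * 2 ^ j)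
    (hF : ∀ S₁ S₂ : ℕ, F S₁ S₂ = Φ (min (2 * S₁ + 1) (2 * S₂ + 1)) (2 * (S₁ : ℤ) + 2 * (S₂ : ℤ) + (t + 2))) (M : ℕ) :
    F (M + 1) (M + 1) - F M (M + 1) - F (M + 1) M + F M M = 4 * ((t + 2) * 2 ^ M) := by
  have key := stencil_tie_R 2 (t + 2) Φ F hodd hF M
  linear_combination key

/-- O-tie `(O,L)|(O,L)`, `L = M+1 ≥ 2`: `2w = 2^{L−1}(3t−1)`, i.e. `m = w/2 = 2^{L−1}(3t−1)/4`.
Dictionary: `a₂ = min(2S₁, 2S₂)`, `s = 2S₁+2S₂+(t−2)` on the route region `S₁, S₂ ≥ 1`; `stencil_tie_U` at `p = 2`, `t ↦ t−2`. -/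
theorem oo_tie (t : ℤ) (Φ : ℕ → ℤ → ℤ) (F : ℕ → ℕ → ℤ)
    (heven : ∀ (m : ℕ) (s : ℤ),
      Φ (2 * m) s = 2 * (∑ j ∈ range m, (s - 4 * (j : ℤ)) * 2 ^ j) + (s - 4 * (m : ℤ) + 1) * 2 ^ m)
    (hF : ∀ S₁ S₂ : ℕ, 1 ≤ S₁ → 1 ≤ S₂ →
      F S₁ S₂ = Φ (min (2 * S₁) (2 * S₂)) (2 * (S₁ : ℤ) + 2 * (S₂ : ℤ) + (t - 2)))
    (M : ℕ) (hM : 1 ≤ M) :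
    F (M + 1) (M + 1) - F M (M + 1) - F (M + 1) M + F M M = 2 ^ M * (3 * t - 1) := by
  have key := stencil_tie_U 2 (t - 2) Φ
    (fun S₁ S₂ => Φ (min (2 * S₁) (2 * S₂)) (2 * (S₁ : ℤ) + 2 * (S₂ : ℤ) + (t - 2))) heven (fun _ _ => rfl) M
  beta_reduce at key
  rw [hF (M + 1) (M + 1) (by omega) (by omega), hF M (M + 1) hM (by omega), hF (M + 1) M (by omega) hM, hF M M hM hM]
  linear_combination key

/-- EE, side 1 strictly lower: `(E,L₁)|(E,L₂)`, `L₁ < L₂` (`Lᵢ = Mᵢ+1`): `2w = 4·2^{L₁} = 2·e_{L₁}(E)`, every `t`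
(`e_L(E) = 2^{L+1}`).  `stencil_sep_R` at `p = 2`, `e₂ = 1`, `t ↦ t+2`. -/
theorem ee_sep (t : ℤ) (Φ : ℕ → ℤ → ℤ) (F : ℕ → ℕ → ℤ)
    (hodd : ∀ (m : ℕ) (s : ℤ), Φ (2 * m + 1) s = 2 * ∑ j ∈ range (m + 1), (s - 4 * (j : ℤ)) * 2 ^ j)
    (hF : ∀ S₁ S₂ : ℕ, F S₁ S₂ = Φ (min (2 * S₁ + 1) (2 * S₂ + 1)) (2 * (S₁ : ℤ) + 2 * (S₂ : ℤ) + (t + 2)))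
    (M₁ M₂ : ℕ) (h : M₁ < M₂) :
    F (M₁ + 1) (M₂ + 1) - F M₁ (M₂ + 1) - F (M₁ + 1) M₂ + F M₁ M₂ = 2 * 2 ^ (M₁ + 2) := by
  have key := stencil_sep_R 2 (t + 2) 1 Φ F hodd hF M₁ M₂ (by omega)
  rw [key]; ring

/-- EO, E side strictly lower and separated: `(E,L₁)|(O,L₂)`, `L₂ ≥ L₁ + 2`: `2w = 2·e_{L₁}(E)`, every `t`.
`stencil_sep_R` at `p = 2`, `e₂ = 0`, `t ↦ t` on the route region `S₂ ≥ 1`. -/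
theorem eo_sep_E (t : ℤ) (Φ : ℕ → ℤ → ℤ) (F : ℕ → ℕ → ℤ)
    (hodd : ∀ (m : ℕ) (s : ℤ), Φ (2 * m + 1) s = 2 * ∑ j ∈ range (m + 1), (s - 4 * (j : ℤ)) * 2 ^ j)
    (hF : ∀ S₁ S₂ : ℕ, 1 ≤ S₂ → F S₁ S₂ = Φ (min (2 * S₁ + 1) (2 * S₂)) (2 * (S₁ : ℤ) + 2 * (S₂ : ℤ) + t))
    (M₁ M₂ : ℕ) (h : M₁ + 2 ≤ M₂) :
    F (M₁ + 1) (M₂ + 1) - F M₁ (M₂ + 1) - F (M₁ + 1) M₂ + F M₁ M₂ = 2 * 2 ^ (M₁ + 2) := by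
  have key := stencil_sep_R 2 t 0 Φ
    (fun S₁ S₂ => Φ (min (2 * S₁ + 1) (2 * S₂ + 0)) (2 * (S₁ : ℤ) + 2 * (S₂ : ℤ) + t)) hodd (fun _ _ => rfl) M₁ M₂ (by omega)
  beta_reduce at key
  simp only [Nat.add_zero] at key
  rw [hF (M₁ + 1) (M₂ + 1) (by omega), hF M₁ (M₂ + 1) (by omega), hF (M₁ + 1) M₂ (by omega), hF M₁ M₂ (by omega)]
  rw [key]; ring

/-- EO, E side lower and ADJACENT: `(E,L)|(O,L+1)`, `L = M+1 ≥ 1` (`e_L(E) = 2^{L+1} < e_{L+1}(O) = 3·2^L`):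
`2w = (t+3)·2^L`, which at the realisable `t = 1` (kinds differ ⇒ `t = 1`, §69.40 (R)) is `2·e_L(E)`.  `stencil_adj_RU` at `p = 2`. -/
theorem eo_adj_E (t : ℤ) (Φ : ℕ → ℤ → ℤ) (F : ℕ → ℕ → ℤ)
    (hodd : ∀ (m : ℕ) (s : ℤ), Φ (2 * m + 1) s = 2 * ∑ j ∈ range (m + 1), (s - 4 * (j : ℤ)) * 2 ^ j)
    (heven : ∀ (m : ℕ) (s : ℤ),
      Φ (2 * m) s = 2 * (∑ j ∈ range m, (s - 4 * (j : ℤ)) * 2 ^ j) + (s - 4 * (m : ℤ) + 1) * 2 ^ m)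
    (hF : ∀ S₁ S₂ : ℕ, 1 ≤ S₂ → F S₁ S₂ = Φ (min (2 * S₁ + 1) (2 * S₂)) (2 * (S₁ : ℤ) + 2 * (S₂ : ℤ) + t))
    (M : ℕ) :
    F (M + 1) (M + 1 + 1) - F M (M + 1 + 1) - F (M + 1) (M + 1) + F M (M + 1) = (t + 3) * 2 ^ (M + 1) := by
  have key := stencil_adj_RU 2 t Φ
    (fun S₁ S₂ => Φ (min (2 * S₁ + 1) (2 * S₂)) (2 * (S₁ : ℤ) + 2 * (S₂ : ℤ) + t)) hodd heven (fun _ _ => rfl) M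
  beta_reduce at key
  rw [hF (M + 1) (M + 1 + 1) (by omega), hF M (M + 1 + 1) (by omega), hF (M + 1) (M + 1) (by omega), hF M (M + 1) (by omega)]
  exact key

/-- The realisable case `t = 1` of `eo_adj_E`: `2w = 4·2^L = 2·e_L(E) = 2·min(e_L(E), e_{L+1}(O))`. -/
theorem eo_adj_E_one (Φ : ℕ → ℤ → ℤ) (F : ℕ → ℕ → ℤ)
    (hodd : ∀ (m : ℕ) (s : ℤ), Φ (2 * m + 1) s = 2 * ∑ j ∈ range (m + 1), (s - 4 * (j : ℤ)) * 2 ^ j)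
    (heven : ∀ (m : ℕ) (s : ℤ),
      Φ (2 * m) s = 2 * (∑ j ∈ range m, (s - 4 * (j : ℤ)) * 2 ^ j) + (s - 4 * (m : ℤ) + 1) * 2 ^ m)
    (hF : ∀ S₁ S₂ : ℕ, 1 ≤ S₂ → F S₁ S₂ = Φ (min (2 * S₁ + 1) (2 * S₂)) (2 * (S₁ : ℤ) + 2 * (S₂ : ℤ) + 1))
    (M : ℕ) :
    F (M + 1) (M + 1 + 1) - F M (M + 1 + 1) - F (M + 1) (M + 1) + F M (M + 1) = 2 * 2 ^ (M + 2) := by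
  rw [eo_adj_E 1 Φ F hodd heven hF M]; ring

/-- EO at EQUAL level `L = M+1 ≥ 2`: the O side is the lower one (`e_L(O) = 3·2^{L−1} < e_L(E) = 2^{L+1}`); `(E,L)|(O,L)`:
`2w = 2·3·2^{L−1} + (t−1)·2^L`, which at the realisable `t = 1` is `2·e_L(O)` (the mirror of `stencil_adj_UR` at `p = 2`, proved
by the recipe of anchor 100: (A) `sum_affine`, (B) `Finset.sum_range_succ`, `ring`). -/
theorem eo_eq_O (t : ℤ) (Φ : ℕ → ℤ → ℤ) (F : ℕ → ℕ → ℤ)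
    (hodd : ∀ (m : ℕ) (s : ℤ), Φ (2 * m + 1) s = 2 * ∑ j ∈ range (m + 1), (s - 4 * (j : ℤ)) * 2 ^ j)
    (heven : ∀ (m : ℕ) (s : ℤ),
      Φ (2 * m) s = 2 * (∑ j ∈ range m, (s - 4 * (j : ℤ)) * 2 ^ j) + (s - 4 * (m : ℤ) + 1) * 2 ^ m)
    (hF : ∀ S₁ S₂ : ℕ, 1 ≤ S₂ → F S₁ S₂ = Φ (min (2 * S₁ + 1) (2 * S₂)) (2 * (S₁ : ℤ) + 2 * (S₂ : ℤ) + t))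
    (M : ℕ) (hM : 1 ≤ M) :
    F (M + 1) (M + 1) - F M (M + 1) - F (M + 1) M + F M M = 2 * (3 * 2 ^ M) + (t - 1) * 2 ^ (M + 1) := by
  have h1 : min (2 * (M + 1) + 1) (2 * (M + 1)) = 2 * (M + 1) := by omega
  have h2 : min (2 * M + 1) (2 * (M + 1)) = 2 * M + 1 := by omega
  have h3 : min (2 * (M + 1) + 1) (2 * M) = 2 * M := by omega
  have h4 : min (2 * M + 1) (2 * M) = 2 * M := by omega
  rw [hF (M + 1) (M + 1) (by omega), hF M (M + 1) (by omega), hF (M + 1) M hM, hF M M hM, h1, h2, h3, h4]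
  rw [heven (M + 1), hodd M, heven M, heven M]
  simp only [sum_affine]
  rw [sum_range_succ (fun j => (2 : ℤ) ^ j) M, sum_range_succ (fun j => (j : ℤ) * (2 : ℤ) ^ j) M]
  push_cast
  ring

/-- The realisable case `t = 1` of `eo_eq_O`: `2w = 2·3·2^{L−1} = 2·e_L(O) = 2·min(e_L(E), e_L(O))`, `L = M+1 ≥ 2`. -/
theorem eo_eq_O_one (Φ : ℕ → ℤ → ℤ) (F : ℕ → ℕ → ℤ)
    (hodd : ∀ (m : ℕ) (s : ℤ), Φ (2 * m + 1) s = 2 * ∑ j ∈ range (m + 1), (s - 4 * (j : ℤ)) * 2 ^ j)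
    (heven : ∀ (m : ℕ) (s : ℤ),
      Φ (2 * m) s = 2 * (∑ j ∈ range m, (s - 4 * (j : ℤ)) * 2 ^ j) + (s - 4 * (m : ℤ) + 1) * 2 ^ m)
    (hF : ∀ S₁ S₂ : ℕ, 1 ≤ S₂ → F S₁ S₂ = Φ (min (2 * S₁ + 1) (2 * S₂)) (2 * (S₁ : ℤ) + 2 * (S₂ : ℤ) + 1))
    (M : ℕ) (hM : 1 ≤ M) :
    F (M + 1) (M + 1) - F M (M + 1) - F (M + 1) M + F M M = 2 * (3 * 2 ^ M) := by
  rw [eo_eq_O 1 Φ F hodd heven hF M hM]; ring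

/-- EO, O side at a STRICTLY LOWER level `2 ≤ L₂ < L₁` (`Lᵢ = Mᵢ+1`; the O side is the lower one, `e_{L₂}(O) = 3·2^{L₂−1} < 2^{L₁+1}`;
in the stencil `2L₂ ≤ 2(L₁−1)+1`): `2w = 2·3·2^{L₂−1} = 2·e_{L₂}(O)`, every `t`.  `stencil_sep_U'` at `p = 2`, `e₁ = 1`. -/
theorem eo_sep_O (t : ℤ) (Φ : ℕ → ℤ → ℤ) (F : ℕ → ℕ → ℤ)
    (heven : ∀ (m : ℕ) (s : ℤ),
      Φ (2 * m) s = 2 * (∑ j ∈ range m, (s - 4 * (j : ℤ)) * 2 ^ j) + (s - 4 * (m : ℤ) + 1) * 2 ^ m)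
    (hF : ∀ S₁ S₂ : ℕ, 1 ≤ S₂ → F S₁ S₂ = Φ (min (2 * S₁ + 1) (2 * S₂)) (2 * (S₁ : ℤ) + 2 * (S₂ : ℤ) + t))
    (M₁ M₂ : ℕ) (hM₂ : 1 ≤ M₂) (h : M₂ < M₁) :
    F (M₁ + 1) (M₂ + 1) - F M₁ (M₂ + 1) - F (M₁ + 1) M₂ + F M₁ M₂ = 2 * (3 * 2 ^ M₂) := by
  have key := stencil_sep_U' 2 t 1 Φ
    (fun S₁ S₂ => Φ (min (2 * S₁ + 1) (2 * S₂)) (2 * (S₁ : ℤ) + 2 * (S₂ : ℤ) + t)) heven (fun _ _ => rfl) M₁ M₂ (by omega)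
  beta_reduce at key
  rw [hF (M₁ + 1) (M₂ + 1) (by omega), hF M₁ (M₂ + 1) (by omega), hF (M₁ + 1) M₂ hM₂, hF M₁ M₂ hM₂]
  rw [key]; ring

/-- OO, side 1 strictly lower: `(O,L₁)|(O,L₂)`, `2 ≤ L₁ < L₂`: `2w = 2·e_{L₁}(O)`, every `t`.  `stencil_sep_U`, `p = 2`, `e₂ = 0`, `t ↦ t−2`. -/
theorem oo_sep (t : ℤ) (Φ : ℕ → ℤ → ℤ) (F : ℕ → ℕ → ℤ)
    (heven : ∀ (m : ℕ) (s : ℤ),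
      Φ (2 * m) s = 2 * (∑ j ∈ range m, (s - 4 * (j : ℤ)) * 2 ^ j) + (s - 4 * (m : ℤ) + 1) * 2 ^ m)
    (hF : ∀ S₁ S₂ : ℕ, 1 ≤ S₁ → 1 ≤ S₂ →
      F S₁ S₂ = Φ (min (2 * S₁) (2 * S₂)) (2 * (S₁ : ℤ) + 2 * (S₂ : ℤ) + (t - 2)))
    (M₁ M₂ : ℕ) (hM₁ : 1 ≤ M₁) (h : M₁ < M₂) :
    F (M₁ + 1) (M₂ + 1) - F M₁ (M₂ + 1) - F (M₁ + 1) M₂ + F M₁ M₂ = 2 * (3 * 2 ^ M₁) := by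
  have key := stencil_sep_U 2 (t - 2) 0 Φ
    (fun S₁ S₂ => Φ (min (2 * S₁) (2 * S₂ + 0)) (2 * (S₁ : ℤ) + 2 * (S₂ : ℤ) + (t - 2))) heven (fun _ _ => rfl) M₁ M₂ (by omega)
  beta_reduce at key
  simp only [Nat.add_zero] at key
  rw [hF (M₁ + 1) (M₂ + 1) (by omega) (by omega), hF M₁ (M₂ + 1) hM₁ (by omega), hF (M₁ + 1) M₂ (by omega) (by omega),
    hF M₁ M₂ hM₁ (by omega)]
  rw [key]; ring

/-! ## Layer B′ — corners with a kind-O side at level 0 (canonical lift; Theorem G clause (E3)) and the kind-E level-0 boundary -/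

/-- EO with the O side at level `1` and the E side at level `L = M+1 ≥ 2`: with (E3) `G(S,0) = S+1` (doubled: `F S 0 = 2(S+1)`),
`2w = F(L,1) − F(L−1,1) − F(L,0) + F(L−1,0) = 8 − 2 = 6 = 2·e_1(O)`, every `t`. -/
theorem eo_O1 (t : ℤ) (Φ : ℕ → ℤ → ℤ) (F : ℕ → ℕ → ℤ)
    (heven : ∀ (m : ℕ) (s : ℤ),
      Φ (2 * m) s = 2 * (∑ j ∈ range m, (s - 4 * (j : ℤ)) * 2 ^ j) + (s - 4 * (m : ℤ) + 1) * 2 ^ m)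
    (hF : ∀ S₁ S₂ : ℕ, 1 ≤ S₂ → F S₁ S₂ = Φ (min (2 * S₁ + 1) (2 * S₂)) (2 * (S₁ : ℤ) + 2 * (S₂ : ℤ) + t))
    (hE3 : ∀ S₁ : ℕ, F S₁ 0 = 2 * ((S₁ : ℤ) + 1))
    (M : ℕ) (hM : 1 ≤ M) :
    F (M + 1) 1 - F M 1 - F (M + 1) 0 + F M 0 = 2 * 3 := by
  have h1 : min (2 * (M + 1) + 1) (2 * 1) = 2 * 1 := by omega
  have h2 : min (2 * M + 1) (2 * 1) = 2 * 1 := by omega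
  rw [hF (M + 1) 1 le_rfl, hF M 1 le_rfl, hE3, hE3, h1, h2, heven 1, heven 1]
  simp only [sum_range_succ, sum_range_zero]
  push_cast
  ring

/-- EO with BOTH sides at level `1` (the O side is the lower one, `e_1(O) = 3 < e_1(E) = 4`):
`2w = F(1,1) − F(0,1) − F(1,0) + F(0,0) = 4 + 2t`, which at the realisable `t = 1` is `6 = 2·e_1(O)`. -/
theorem eo_11 (t : ℤ) (Φ : ℕ → ℤ → ℤ) (F : ℕ → ℕ → ℤ)
    (hodd : ∀ (m : ℕ) (s : ℤ), Φ (2 * m + 1) s = 2 * ∑ j ∈ range (m + 1), (s - 4 * (j : ℤ)) * 2 ^ j)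
    (heven : ∀ (m : ℕ) (s : ℤ),
      Φ (2 * m) s = 2 * (∑ j ∈ range m, (s - 4 * (j : ℤ)) * 2 ^ j) + (s - 4 * (m : ℤ) + 1) * 2 ^ m)
    (hF : ∀ S₁ S₂ : ℕ, 1 ≤ S₂ → F S₁ S₂ = Φ (min (2 * S₁ + 1) (2 * S₂)) (2 * (S₁ : ℤ) + 2 * (S₂ : ℤ) + t))
    (hE3 : ∀ S₁ : ℕ, F S₁ 0 = 2 * ((S₁ : ℤ) + 1)) :
    F 1 1 - F 0 1 - F 1 0 + F 0 0 = 4 + 2 * t := by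
  have h1 : min (2 * 1 + 1) (2 * 1) = 2 * 1 := by omega
  have h2 : min (2 * 0 + 1) (2 * 1) = 2 * 0 + 1 := by omega
  rw [hF 1 1 le_rfl, hF 0 1 le_rfl, hE3, hE3, h1, h2, heven 1, hodd 0]
  simp only [sum_range_succ, sum_range_zero]
  push_cast
  ring

/-- EO with the E side at level `0` (conductor-odd at 2, `d = −4c` fundamental) against the O side at level `1`: `G(−1,·) = 0`, so
`2w = F(0,1) − F(0,0) = 2(t+2) − 2 = 2t + 2`, which at the realisable `t = 1` is `4 = 2·e_0(E)`. -/
theorem eo_01 (t : ℤ) (Φ : ℕ → ℤ → ℤ) (F : ℕ → ℕ → ℤ)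
    (hodd : ∀ (m : ℕ) (s : ℤ), Φ (2 * m + 1) s = 2 * ∑ j ∈ range (m + 1), (s - 4 * (j : ℤ)) * 2 ^ j)
    (hF : ∀ S₁ S₂ : ℕ, 1 ≤ S₂ → F S₁ S₂ = Φ (min (2 * S₁ + 1) (2 * S₂)) (2 * (S₁ : ℤ) + 2 * (S₂ : ℤ) + t))
    (hE3 : ∀ S₁ : ℕ, F S₁ 0 = 2 * ((S₁ : ℤ) + 1)) :
    F 0 1 - F 0 0 = 2 * t + 2 := by
  have h2 : min (2 * 0 + 1) (2 * 1) = 2 * 0 + 1 := by omega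
  rw [hF 0 1 le_rfl, hE3, h2, hodd 0]
  simp only [sum_range_succ, sum_range_zero]
  push_cast
  ring

/-- OO with side 1 at level `1` and side 2 at level `L₂ = M₂+1 ≥ 2`: with (E3) `G(0,S₂) = δ₀ + S₂` (`S₂ ≥ 1`; doubled `F 0 S₂ = 2(δ₀+S₂)`),
`2w = F(1,L₂) − F(0,L₂) − F(1,L₂−1) + F(0,L₂−1) = 8 − 2 = 6 = 2·e_1(O)`, every `t` and every `δ₀`. -/
theorem oo_1L (t δ₀ : ℤ) (Φ : ℕ → ℤ → ℤ) (F : ℕ → ℕ → ℤ)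
    (heven : ∀ (m : ℕ) (s : ℤ),
      Φ (2 * m) s = 2 * (∑ j ∈ range m, (s - 4 * (j : ℤ)) * 2 ^ j) + (s - 4 * (m : ℤ) + 1) * 2 ^ m)
    (hF : ∀ S₁ S₂ : ℕ, 1 ≤ S₁ → 1 ≤ S₂ →
      F S₁ S₂ = Φ (min (2 * S₁) (2 * S₂)) (2 * (S₁ : ℤ) + 2 * (S₂ : ℤ) + (t - 2)))
    (hE3 : ∀ S₂ : ℕ, 1 ≤ S₂ → F 0 S₂ = 2 * (δ₀ + (S₂ : ℤ)))
    (M₂ : ℕ) (hM₂ : 1 ≤ M₂) :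
    F 1 (M₂ + 1) - F 0 (M₂ + 1) - F 1 M₂ + F 0 M₂ = 2 * 3 := by
  have h1 : min (2 * 1) (2 * (M₂ + 1)) = 2 * 1 := by omega
  have h2 : min (2 * 1) (2 * M₂) = 2 * 1 := by omega
  rw [hF 1 (M₂ + 1) le_rfl (by omega), hF 1 M₂ le_rfl hM₂, hE3 (M₂ + 1) (by omega), hE3 M₂ hM₂, h1, h2, heven 1, heven 1]
  simp only [sum_range_succ, sum_range_zero]
  push_cast
  ring

/-- The O-tie at level `1` (the only corner where Gross's `δ₀` is load-bearing): with (E3) `G(0,1) = G(1,0) = δ₀ + 1`, `G(0,0) = δ₀`,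
`2w = F(1,1) − F(0,1) − F(1,0) + F(0,0) = 2(2t+1) − 4(δ₀+1) + 2δ₀ = 4t − 2 − 2δ₀`. -/
theorem oo_11 (t δ₀ : ℤ) (Φ : ℕ → ℤ → ℤ) (F : ℕ → ℕ → ℤ)
    (heven : ∀ (m : ℕ) (s : ℤ),
      Φ (2 * m) s = 2 * (∑ j ∈ range m, (s - 4 * (j : ℤ)) * 2 ^ j) + (s - 4 * (m : ℤ) + 1) * 2 ^ m)
    (hF : ∀ S₁ S₂ : ℕ, 1 ≤ S₁ → 1 ≤ S₂ →
      F S₁ S₂ = Φ (min (2 * S₁) (2 * S₂)) (2 * (S₁ : ℤ) + 2 * (S₂ : ℤ) + (t - 2)))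
    (hE3a : F 0 1 = 2 * (δ₀ + 1)) (hE3b : F 1 0 = 2 * (δ₀ + 1)) (hE3c : F 0 0 = 2 * δ₀) :
    F 1 1 - F 0 1 - F 1 0 + F 0 0 = 4 * t - 2 - 2 * δ₀ := by
  have h1 : min (2 * 1) (2 * 1) = 2 * 1 := by omega
  rw [hF 1 1 le_rfl le_rfl, hE3a, hE3b, hE3c, h1, heven 1]
  simp only [sum_range_succ, sum_range_zero]
  push_cast
  ring

/-- … and under the δ₀-dictionary `2δ₀ = t − 1` (Layer C: `δ₀ = min v₂(u₁×u₂)`, `t = 2δ₀ + 1` for realisable pairs) the level-1 O-tie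
weight is `2w = 3t − 1`, i.e. `m = w/2 = (3t−1)/4` = UL-O1 of record. -/
theorem oo_11_dict (t δ₀ : ℤ) (Φ : ℕ → ℤ → ℤ) (F : ℕ → ℕ → ℤ)
    (heven : ∀ (m : ℕ) (s : ℤ),
      Φ (2 * m) s = 2 * (∑ j ∈ range m, (s - 4 * (j : ℤ)) * 2 ^ j) + (s - 4 * (m : ℤ) + 1) * 2 ^ m)
    (hF : ∀ S₁ S₂ : ℕ, 1 ≤ S₁ → 1 ≤ S₂ →
      F S₁ S₂ = Φ (min (2 * S₁) (2 * S₂)) (2 * (S₁ : ℤ) + 2 * (S₂ : ℤ) + (t - 2)))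
    (hE3a : F 0 1 = 2 * (δ₀ + 1)) (hE3b : F 1 0 = 2 * (δ₀ + 1)) (hE3c : F 0 0 = 2 * δ₀) (hδ : 2 * δ₀ = t - 1) :
    F 1 1 - F 0 1 - F 1 0 + F 0 0 = 3 * t - 1 := by
  rw [oo_11 t δ₀ Φ F heven hF hE3a hE3b hE3c]; linarith

/-- The kind-E level-0 boundary (E′ of §69.31 / LL's `L_low = 0`): E side at level `0` against an E side at level `L₂ = M₂+1 ≥ 1`:
`2w = F(0,L₂) − F(0,L₂−1) = 4 = 2·e_0(E)`, every `t`. -/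
theorem ee_0L (t : ℤ) (Φ : ℕ → ℤ → ℤ) (F : ℕ → ℕ → ℤ)
    (hodd : ∀ (m : ℕ) (s : ℤ), Φ (2 * m + 1) s = 2 * ∑ j ∈ range (m + 1), (s - 4 * (j : ℤ)) * 2 ^ j)
    (hF : ∀ S₁ S₂ : ℕ, F S₁ S₂ = Φ (min (2 * S₁ + 1) (2 * S₂ + 1)) (2 * (S₁ : ℤ) + 2 * (S₂ : ℤ) + (t + 2))) (M₂ : ℕ) :
    F 0 (M₂ + 1) - F 0 M₂ = 2 * 2 := by
  have h1 : min (2 * 0 + 1) (2 * (M₂ + 1) + 1) = 2 * 0 + 1 := by omega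
  have h2 : min (2 * 0 + 1) (2 * M₂ + 1) = 2 * 0 + 1 := by omega
  rw [hF, hF, h1, h2, hodd 0, hodd 0]
  simp only [sum_range_succ, sum_range_zero]
  push_cast
  ring

/-- The kind-E level-0 boundary against an O side at level `L₂ = M₂+1 ≥ 2`: `2w = F(0,L₂) − F(0,L₂−1) = 4 = 2·e_0(E)`, every `t`. -/
theorem eo_0L (t : ℤ) (Φ : ℕ → ℤ → ℤ) (F : ℕ → ℕ → ℤ)
    (hodd : ∀ (m : ℕ) (s : ℤ), Φ (2 * m + 1) s = 2 * ∑ j ∈ range (m + 1), (s - 4 * (j : ℤ)) * 2 ^ j)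
    (hF : ∀ S₁ S₂ : ℕ, 1 ≤ S₂ → F S₁ S₂ = Φ (min (2 * S₁ + 1) (2 * S₂)) (2 * (S₁ : ℤ) + 2 * (S₂ : ℤ) + t))
    (M₂ : ℕ) (hM₂ : 1 ≤ M₂) :
    F 0 (M₂ + 1) - F 0 M₂ = 2 * 2 := by
  have h1 : min (2 * 0 + 1) (2 * (M₂ + 1)) = 2 * 0 + 1 := by omega
  have h2 : min (2 * 0 + 1) (2 * M₂) = 2 * 0 + 1 := by omega
  rw [hF 0 (M₂ + 1) (by omega), hF 0 M₂ hM₂, h1, h2, hodd 0, hodd 0]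
  simp only [sum_range_succ, sum_range_zero]
  push_cast
  ring

/-- Both sides kind E at level `0` (both discriminants fundamental and even — the [GZ85] cell, outside UL; filed for completeness):
`2·G(0,0) = F 0 0 = 2(t+2)`. -/
theorem ee_00 (t : ℤ) (Φ : ℕ → ℤ → ℤ) (F : ℕ → ℕ → ℤ)
    (hodd : ∀ (m : ℕ) (s : ℤ), Φ (2 * m + 1) s = 2 * ∑ j ∈ range (m + 1), (s - 4 * (j : ℤ)) * 2 ^ j)
    (hF : ∀ S₁ S₂ : ℕ, F S₁ S₂ = Φ (min (2 * S₁ + 1) (2 * S₂ + 1)) (2 * (S₁ : ℤ) + 2 * (S₂ : ℤ) + (t + 2))) :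
    F 0 0 = 2 * (t + 2) := by
  have h1 : min (2 * 0 + 1) (2 * 0 + 1) = 2 * 0 + 1 := by omega
  rw [hF, h1, hodd 0]
  simp only [sum_range_succ, sum_range_zero]
  push_cast
  ring

end Summit.HodgeConjecture.HodgeConjecture.HodgeLocus.Census.GKStencilDyadic
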